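import Summits.NavierStokesRegularity.NavierStokesRegularity.Theorems.SoloRefuteSmith2006
import Summits.NavierStokesRegularity.NavierStokesRegularity.Theorems.SoloRefuteSmith2006ForcingSlab

/-!
# D-0090 NS-CLAIMS, claim C06 `Smith2006` — the CHARITABLE grain of Step 2 is false (part B)

Cell `ns-claims`; UG CROSS-CHECK PROGRAMME (RULINGS v1.31c (5) / v1.31f (2)); obstruction typist-12
g3 (claims/Smith2006/UGNOTE-C06-typist12.md), REF-lane check ref-2 g4 (STATUS 2026-08-27T04:34:25Z /
04:36:12Z), UG-AUDIT home refuter-2 g3. Every theorem here NEGATES a `def … : Prop` of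
`Literature.Claims.NS.Smith2006` (P. Smith, arXiv:math/0609740 v4, withdrawn v5) by an explicit
witness; nothing is asserted about the Navier–Stokes system.

## `not_Theorem2Barriers'` — Step 2′ (Thm 2 (1)–(4) pp. 3–4, l. 266–317, CHARITABLE item (3))

Item (3) read charitably: the barrier pair may depend on `λ`, only the bound `M` is uniform in `λ`.

Forcing obstruction, inside the printed hypotheses of Thm 2: `T = ∞` is admitted (l. 267 «0 ≤ t̂ ≤ t
≤ T ≤ ∞»), the barriers lie in `H^{2,2}(D_T)` of the whole slab `D_∞ = [t̂, ∞) × ℝ³` (l. 278–283),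
and the right-hand side `F` is only «continuous and bounded and decaying to zero at spacial
infinity» (l. 273–274) — no decay in time. Take `t̂ = 0`, `S = [0, ∞)`, `W₀ = 0`, and `F = (0, (β,
0, 0))` with `β` the smooth bump (`= 1` on the closed unit ball, support in the ball of radius `2`).
A supersolution `V^#` (for any one `λ`, here `1/8`) has its `v₁`-row residual `∂ₜv₁ + Σₖ vₖ∂ₖv₁ +
∂₁P − Σₖ∂ₖΥ₁ₖ − β ≥ 0` (`auxResidualV … 0`). On the cylinder `A_N = [1, N+1] × B̄(0,1)` (interior
times, where all derivatives are classical) this gives pointwise `1 ≤ ∂ₜv₁ + 3M‖∇v₁‖ + ‖∇P‖ +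
Σₖ‖∇Υ₁ₖ‖` (space-time gradients, `|vₖ| ≤ M`), hence by `a ≤ ε/2 + a²/(2ε)` with `ε = 1/(3M+4)`: `1/2
≤ ∂ₜv₁ + ((3M+4)/2)·(3M‖∇v₁‖² + ‖∇P‖² + Σₖ‖∇Υ₁ₖ‖²)`. Integrating over `A_N`: the time derivative
telescopes (Fubini + FTC) to `∫_B̄ (v₁(N+1,·) − v₁(1,·)) ≤ 2M·|B̄|`, and the squared gradients are
bounded by the (finite, `N`-independent) `H^{2,2}(D_∞)` integrals of `IsH22OnSlab` (order `k = 1`).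
So `N·|B̄|/2 ≤ 2M|B̄| + const` for every `N > 0` — impossible. Neither `λ`, nor the datum, nor the
subsolution, nor the `p`- and `Υ`-rows are used. The literal Step 2 (`Theorem2Barriers`) is already
kernel-false (`not_Theorem2Barriers`, initial-layer witness, `SoloRefuteSmith2006.lean`); composing
the present theorem with `theorem2Barriers'_of_literal` gives a second, `λ`-free route to that same
negation (not restated here: the gate de-duplicates by type). The CONSUMED instance
`Theorem2BarriersHeywood` (`F ≡ 0`) is NOT touched (no forcing floor). The slab calculus (space-time
gradient `sg`, `K1`, cylinder Fubini + FTC) is part A, `SoloRefuteSmith2006ForcingSlab.lean`.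

WHAT THIS IS NOT: not a claim about NS regularity or blow-up; not a claim about any author beyond
the typed locator.
-/

-- The summit's canonical theorem namespace repeats the summit name (single-conjunct summit).
set_option linter.dupNamespace false

noncomputable section

open Set Function MeasureTheory Metric Filter
open scoped ContDiff ENNReal Topology

namespace Summit.NavierStokesRegularity.NavierStokesRegularity.Theorems.Smith2006

open Literature.Claims.NS.Smith2006
/-! ### The instance: zero datum, bump forcing in the `v₁`-row -/

/-- The zero Cauchy datum. [folklore] -/
def W₀zero : AuxData := ⟨fun _ => 0, fun _ _ => 0, fun _ _ _ => 0⟩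

/-- The zero datum is admissible. [folklore] -/
theorem W₀zero_isAdmissible : W₀zero.IsAdmissible :=
  ⟨isHInftyScalar_zero, fun _ => isHInftyScalar_zero, fun _ _ => isHInftyScalar_zero⟩

/-- The forcing `F = (F₁, f) = (0, (β, 0, 0))`: a time-independent smooth bump in the first
velocity row. [folklore] -/
def Fbump : AuxForce := ⟨fun _ _ => 0, fun _ x i => if i = 0 then (β : R3 → ℝ) x else 0⟩

/-- `Fbump.f t x 0 = β x`. [folklore] -/
theorem Fbump_f_zero (t : ℝ) (x : R3) : Fbump.f t x 0 = (β : R3 → ℝ) x := by simp [Fbump]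

/-- `β = 1` on the closed unit ball. [folklore] -/
theorem β_eq_one {x : R3} (hx : x ∈ closedBall (0 : R3) 1) : (β : R3 → ℝ) x = 1 :=
  β.one_of_mem_closedBall (by simpa [β] using hx)

/-- `β = 0` outside the ball of radius `2`. [folklore] -/
theorem β_eq_zero {x : R3} (hx : 2 ≤ ‖x‖) : (β : R3 → ℝ) x = 0 :=
  β.zero_of_le_dist (by simpa [β] using hx)

/-- The bump forcing is admissible on `[0, ∞)`: continuous, bounded by `1`, vanishing for `‖x‖ ≥ 2`
uniformly in `t`. [folklore] -/
theorem Fbump_isAdmissible : Fbump.IsAdmissible (Ici 0) := by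
  refine ⟨⟨continuousOn_const, fun i => ?_⟩, ⟨1, fun t _ x => by simp [Fbump], fun i t _ x => ?_⟩,
    fun ε hε => ⟨2, fun t _ x hx => ⟨by simpa [Fbump] using hε.le, fun i => ?_⟩⟩⟩
  · by_cases hi : i = 0
    · subst hi
      have : (uncurry fun (t : ℝ) (x : R3) => Fbump.f t x 0) = fun q => (β : R3 → ℝ) q.2 := by
        funext ⟨t, x⟩; simp [Fbump]
      rw [this]
      exact (β.continuous.comp continuous_snd).continuousOn
    · have : (uncurry fun (t : ℝ) (x : R3) => Fbump.f t x i) = fun _ => 0 := by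
        funext ⟨t, x⟩; simp [Fbump, hi]
      rw [this]
      exact continuousOn_const
  · show |Fbump.f t x i| ≤ 1
    by_cases hi : i = 0
    · subst hi
      rw [Fbump_f_zero, abs_of_nonneg (β.nonneg)]
      exact β.le_one
    · simp [Fbump, hi]
  · by_cases hi : i = 0
    · subst hi
      rw [Fbump_f_zero, β_eq_zero hx, abs_zero]
      exact hε.le
    · simp [Fbump, hi, hε.le]

/-! ### Real-arithmetic helpers -/

/-- `a ≤ ε/2 + a²/(2ε)` for `ε > 0`. [folklore] -/
theorem le_amgm (a ε : ℝ) (hε : 0 < ε) : a ≤ ε / 2 + a ^ 2 / (2 * ε) := by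
  have h : ε / 2 + a ^ 2 / (2 * ε) - a = (a - ε) ^ 2 / (2 * ε) := by
    field_simp
    ring
  have h' : 0 ≤ (a - ε) ^ 2 / (2 * ε) := div_nonneg (sq_nonneg _) (by positivity)
  linarith

/-- Three bounded coefficients against three bounded partials. [folklore] -/
theorem abs_sum3_le {a₀ a₁ a₂ p₀ p₁ p₂ M g : ℝ} (ha₀ : |a₀| ≤ M) (ha₁ : |a₁| ≤ M) (ha₂ : |a₂| ≤ M)
    (hp₀ : |p₀| ≤ g) (hp₁ : |p₁| ≤ g) (hp₂ : |p₂| ≤ g) :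
    |a₀ * p₀ + a₁ * p₁ + a₂ * p₂| ≤ 3 * M * g := by
  have hM : 0 ≤ M := (abs_nonneg _).trans ha₀
  have h0 : |a₀ * p₀| ≤ M * g := by
    rw [abs_mul]; exact mul_le_mul ha₀ hp₀ (abs_nonneg _) hM
  have h1 : |a₁ * p₁| ≤ M * g := by
    rw [abs_mul]; exact mul_le_mul ha₁ hp₁ (abs_nonneg _) hM
  have h2 : |a₂ * p₂| ≤ M * g := by
    rw [abs_mul]; exact mul_le_mul ha₂ hp₂ (abs_nonneg _) hM
  calc |a₀ * p₀ + a₁ * p₁ + a₂ * p₂| ≤ |a₀ * p₀ + a₁ * p₁| + |a₂ * p₂| := abs_add_le _ _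
    _ ≤ |a₀ * p₀| + |a₁ * p₁| + |a₂ * p₂| := by linarith [abs_add_le (a₀ * p₀) (a₁ * p₁)]
    _ ≤ 3 * M * g := by linarith

/-- The pointwise absorption step: from `1 ≤ T + 3M g + b + (c₀ + c₁ + c₂)` with non-negative
`g, b, cₖ` (norms) to `1/2 ≤ T + ((3M+4)/2)·(3M g² + b² + c₀² + c₁² + c₂²)`
(`a ≤ ε/2 + a²/(2ε)` with `ε = 1/(3M+4)`). [folklore] -/
theorem pointwise_absorb {M T g b c₀ c₁ c₂ : ℝ} (hM : 0 ≤ M)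
    (h : 1 ≤ T + 3 * M * g + b + (c₀ + c₁ + c₂)) :
    1 / 2 ≤ T + (3 * M + 4) / 2 * (3 * M * g ^ 2 + b ^ 2 + c₀ ^ 2 + c₁ ^ 2 + c₂ ^ 2) := by
  set ε : ℝ := 1 / (3 * M + 4) with hε_def
  have hε : 0 < ε := by positivity
  have hg := le_amgm g ε hε
  have hb := le_amgm b ε hε
  have h0 := le_amgm c₀ ε hε
  have h1 := le_amgm c₁ ε hε
  have h2 := le_amgm c₂ ε hε
  have hMg : 3 * M * g ≤ 3 * M * (ε / 2 + g ^ 2 / (2 * ε)) :=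
    mul_le_mul_of_nonneg_left hg (by positivity)
  have hsum : 3 * M * g + b + (c₀ + c₁ + c₂)
      ≤ (3 * M + 4) * (ε / 2)
        + 1 / (2 * ε) * (3 * M * g ^ 2 + b ^ 2 + c₀ ^ 2 + c₁ ^ 2 + c₂ ^ 2) := by
    have e : 3 * M * (ε / 2 + g ^ 2 / (2 * ε)) + (ε / 2 + b ^ 2 / (2 * ε))
        + ((ε / 2 + c₀ ^ 2 / (2 * ε)) + (ε / 2 + c₁ ^ 2 / (2 * ε)) + (ε / 2 + c₂ ^ 2 / (2 * ε)))
        = (3 * M + 4) * (ε / 2)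
          + 1 / (2 * ε) * (3 * M * g ^ 2 + b ^ 2 + c₀ ^ 2 + c₁ ^ 2 + c₂ ^ 2) := by
      field_simp
      ring
    linarith
  have hε1 : (3 * M + 4) * (ε / 2) = 1 / 2 := by
    rw [hε_def]; field_simp
  have hε2 : 1 / (2 * ε) = (3 * M + 4) / 2 := by
    rw [hε_def]; field_simp
  rw [hε1, hε2] at hsum
  linarith

/-! ### Step 2′ is false -/

/-- **C06, the charitable grain of Step 2 is false.** `Theorem2Barriers'` (Thm 2 (1)–(4) pp. 3–4
of arXiv:math/0609740 v4 with item (3) read charitably: `λ`-dependent barriers, `λ`-uniform bound)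
fails at `t̂ = 0`, `S = [0, ∞)`, `W₀ = 0`, `F = (0, (β, 0, 0))`: no bounded `C²` field with
components in `H^{2,2}([0,∞) × ℝ³)` has `v₁`-row residual `≥ 0`, i.e.
`∂ₜv₁ + Σₖ vₖ∂ₖv₁ + ∂₁P − Σₖ∂ₖΥ₁ₖ ≥ β`, for all `t ≥ 0` — integrate over `[1, N+1] × B̄(0,1)` and
let `N → ∞`.
[cite: Smith2006, Thm 2 (1)–(4) pp.3–4] -/
theorem not_Theorem2Barriers' : ¬ Theorem2Barriers' := by
  intro h
  obtain ⟨M, hM⟩ := h 0 (Ici 0) W₀zero Fbump le_rfl (isTimeSlab_Ici 0) W₀zero_isAdmissible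
    Fbump_isAdmissible
  obtain ⟨V, -, ⟨hC2, hH22, -, hBd, -⟩, -, hRes, -⟩ := hM (1 / 8) (by norm_num) (by norm_num)
  -- the components used: `v₁ = V.v · · 0`, `vₖ`, `P`, `Υ₁ₖ = V.Υ · · 0 k`
  have hvC : ∀ k, IsCkOnSlab 2 (Ici 0) (fun t x => V.v t x k) := hC2.2.1
  have hPC : IsCkOnSlab 2 (Ici 0) V.P := hC2.1
  have hYC : ∀ k, IsCkOnSlab 2 (Ici 0) (fun t x => V.Υ t x 0 k) := fun k => hC2.2.2 0 k
  have hvH : IsH22OnSlab (Ici 0) (fun t x => V.v t x 0) := hH22.2.1 0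
  have hPH : IsH22OnSlab (Ici 0) V.P := hH22.1
  have hYH : ∀ k, IsH22OnSlab (Ici 0) (fun t x => V.Υ t x 0 k) := fun k => hH22.2.2 0 k
  have hvB : ∀ k, BoundedBySlab M (Ici 0) (fun t x => V.v t x k) := hBd.2.1
  have hM0 : 0 ≤ M := (abs_nonneg _).trans (hvB 0 1 (by norm_num) 0)
  -- names for the gradients
  set gv : ℝ × R3 → (ℝ × R3 →L[ℝ] ℝ) := sg (fun t x => V.v t x 0) with hgv
  set gP : ℝ × R3 → (ℝ × R3 →L[ℝ] ℝ) := sg V.P with hgP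
  set gY : Fin 3 → ℝ × R3 → (ℝ × R3 →L[ℝ] ℝ) := fun k => sg (fun t x => V.Υ t x 0 k) with hgY
  set c : ℝ := (3 * M + 4) / 2 with hc
  set Q : ℝ × R3 → ℝ := fun q =>
    3 * M * ‖gv q‖ ^ 2 + ‖gP q‖ ^ 2 + ‖gY 0 q‖ ^ 2 + ‖gY 1 q‖ ^ 2 + ‖gY 2 q‖ ^ 2 with hQ
  -- (1) the pointwise inequality on the open slab over the closed unit ball
  have hpt : ∀ q ∈ slab', q.2 ∈ closedBall (0 : R3) 1 → (1 : ℝ) / 2 ≤ gv q (1, 0) + c * Q q := by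
    rintro ⟨t, x⟩ ⟨ht, -⟩ hx
    have ht' : (t : ℝ) ∈ Ici (0 : ℝ) := mem_Ici.mpr (le_of_lt ht)
    have hres : 0 ≤ auxResidualV Fbump (Ici 0) V t x 0 := ((hRes t ht' x).2.1) 0
    have e1 : derivWithin (fun s => V.v s x 0) (Ici 0) t = gv (t, x) (1, 0) :=
      derivWithin_eq_sg (hvC 0) ht x
    have e2 : ∀ k, pd (fun y => V.v t y 0) k x = gv (t, x) (0, EuclideanSpace.single k 1) :=
      fun k => pd_eq_sg (hvC 0) ht x k
    have e3 : pd (V.P t) 0 x = gP (t, x) (0, EuclideanSpace.single 0 1) := pd_eq_sg hPC ht x 0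
    have e4 : ∀ k, pd (fun y => V.Υ t y 0 k) k x = gY k (t, x) (0, EuclideanSpace.single k 1) :=
      fun k => pd_eq_sg (hYC k) ht x k
    have eF : Fbump.f t x 0 = 1 := by rw [Fbump_f_zero, β_eq_one hx]
    unfold auxResidualV at hres
    rw [Fin.sum_univ_three, Fin.sum_univ_three, e1, e2 0, e2 1, e2 2, e3, e4 0, e4 1, e4 2, eF]
      at hres
    -- bounds on the individual terms
    have hadv : |V.v t x 0 * gv (t, x) (0, EuclideanSpace.single 0 1)
        + V.v t x 1 * gv (t, x) (0, EuclideanSpace.single 1 1)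
        + V.v t x 2 * gv (t, x) (0, EuclideanSpace.single 2 1)| ≤ 3 * M * ‖gv (t, x)‖ :=
      abs_sum3_le (hvB 0 t ht' x) (hvB 1 t ht' x) (hvB 2 t ht' x) (abs_apply_space_le _ 0)
        (abs_apply_space_le _ 1) (abs_apply_space_le _ 2)
    have hP := abs_apply_space_le (gP (t, x)) 0
    have hY0 := abs_apply_space_le (gY 0 (t, x)) 0
    have hY1 := abs_apply_space_le (gY 1 (t, x)) 1
    have hY2 := abs_apply_space_le (gY 2 (t, x)) 2
    have key : 1 ≤ gv (t, x) (1, 0) + 3 * M * ‖gv (t, x)‖ + ‖gP (t, x)‖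
        + (‖gY 0 (t, x)‖ + ‖gY 1 (t, x)‖ + ‖gY 2 (t, x)‖) := by
      have h1 := le_abs_self (V.v t x 0 * gv (t, x) (0, EuclideanSpace.single 0 1)
        + V.v t x 1 * gv (t, x) (0, EuclideanSpace.single 1 1)
        + V.v t x 2 * gv (t, x) (0, EuclideanSpace.single 2 1))
      have h2 := le_abs_self (gP (t, x) (0, EuclideanSpace.single 0 1))
      have h3 := neg_abs_le (gY 0 (t, x) (0, EuclideanSpace.single 0 1))
      have h4 := neg_abs_le (gY 1 (t, x) (0, EuclideanSpace.single 1 1))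
      have h5 := neg_abs_le (gY 2 (t, x) (0, EuclideanSpace.single 2 1))
      linarith
    exact pointwise_absorb hM0 key
  -- (2) integrate over the cylinder `A_N = [1, N+1] × B̄(0,1)` for every `N > 0`
  set vB : ℝ := volume.real (closedBall (0 : R3) 1) with hvB_def
  have hvB_pos : 0 < vB := by
    rw [hvB_def, measureReal_def]
    exact ENNReal.toReal_pos (measure_closedBall_pos volume (0 : R3) one_pos).ne'
      (measure_closedBall_lt_top).ne
  set K : ℝ := 3 * M * K1 (fun t x => V.v t x 0) + K1 V.P + K1 (fun t x => V.Υ t x 0 0)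
    + K1 (fun t x => V.Υ t x 0 1) + K1 (fun t x => V.Υ t x 0 2) with hK
  have hK0 : 0 ≤ K := by
    have := K1_nonneg (fun t x => V.v t x 0); have := K1_nonneg V.P
    have := K1_nonneg (fun t x => V.Υ t x 0 0); have := K1_nonneg (fun t x => V.Υ t x 0 1)
    have := K1_nonneg (fun t x => V.Υ t x 0 2)
    positivity
  have hN : ∀ N : ℝ, 0 < N → N * vB / 2 ≤ 2 * M * vB + c * K := by
    intro N hN
    set A : Set (ℝ × R3) := Icc 1 (N + 1) ×ˢ closedBall (0 : R3) 1 with hA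
    have hA' : A ⊆ slab' := cyl_subset one_pos
    have hAc : IsCompact A := isCompact_cyl 1 (N + 1)
    have hAm : MeasurableSet A := measurableSet_cyl 1 (N + 1)
    -- integrability of the pieces
    have hi1 : IntegrableOn (fun q => gv q (1, 0)) A := integrableOn_sg_time (hvC 0) one_pos
    have hiv : IntegrableOn (fun q => ‖gv q‖ ^ 2) A := integrableOn_sg_sq (hvC 0) hA' hAc
    have hiP : IntegrableOn (fun q => ‖gP q‖ ^ 2) A := integrableOn_sg_sq hPC hA' hAc
    have hiY : ∀ k, IntegrableOn (fun q => ‖gY k q‖ ^ 2) A :=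
      fun k => integrableOn_sg_sq (hYC k) hA' hAc
    have hiQ : IntegrableOn Q A :=
      ((((hiv.integrable.const_mul (3 * M)).add hiP.integrable).add (hiY 0).integrable).add
        (hiY 1).integrable).add (hiY 2).integrable
    have hiR : IntegrableOn (fun q => gv q (1, 0) + c * Q q) A :=
      hi1.integrable.add (hiQ.integrable.const_mul c)
    -- the volume of the cylinder
    have hvol : volume.real A = N * vB := by
      rw [hvB_def, measureReal_def, measureReal_def, hA, Measure.volume_eq_prod, Measure.prod_prod,
        Real.volume_Icc, ENNReal.toReal_mul, ENNReal.toReal_ofReal (by linarith)]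
      ring
    -- integrate the pointwise inequality
    have hle : ∫ q in A, (1 : ℝ) / 2 ≤ ∫ q in A, (gv q (1, 0) + c * Q q) := by
      refine setIntegral_mono_on (integrableOn_const (hAc.measure_lt_top.ne)) hiR hAm ?_
      intro q hq
      exact hpt q (hA' hq) hq.2
    rw [setIntegral_const, hvol, smul_eq_mul,
      integral_add hi1.integrable (hiQ.integrable.const_mul c), integral_const_mul] at hle
    -- bound the two integrals
    have hT : ∫ q in A, gv q (1, 0) ≤ 2 * M * vB :=
      (le_abs_self _).trans (abs_integral_sg_time_le (hvC 0) (hvB 0) one_pos (by linarith))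
    have hQle : ∫ q in A, Q q ≤ K := by
      have eQ : ∫ q in A, Q q = 3 * M * (∫ q in A, ‖gv q‖ ^ 2) + (∫ q in A, ‖gP q‖ ^ 2)
          + (∫ q in A, ‖gY 0 q‖ ^ 2) + (∫ q in A, ‖gY 1 q‖ ^ 2) + (∫ q in A, ‖gY 2 q‖ ^ 2) := by
        have i1 : Integrable (fun q => 3 * M * ‖gv q‖ ^ 2) (volume.restrict A) :=
          hiv.integrable.const_mul (3 * M)
        have i2 : Integrable (fun q => ‖gP q‖ ^ 2) (volume.restrict A) := hiP.integrable
        have i3 : Integrable (fun q => ‖gY 0 q‖ ^ 2) (volume.restrict A) := (hiY 0).integrable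
        have i4 : Integrable (fun q => ‖gY 1 q‖ ^ 2) (volume.restrict A) := (hiY 1).integrable
        have i5 : Integrable (fun q => ‖gY 2 q‖ ^ 2) (volume.restrict A) := (hiY 2).integrable
        have i12 : Integrable (fun q => 3 * M * ‖gv q‖ ^ 2 + ‖gP q‖ ^ 2) (volume.restrict A) :=
          i1.add i2
        have i123 : Integrable (fun q => 3 * M * ‖gv q‖ ^ 2 + ‖gP q‖ ^ 2 + ‖gY 0 q‖ ^ 2)
            (volume.restrict A) := i12.add i3
        have i1234 : Integrable (fun q => 3 * M * ‖gv q‖ ^ 2 + ‖gP q‖ ^ 2 + ‖gY 0 q‖ ^ 2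
            + ‖gY 1 q‖ ^ 2) (volume.restrict A) := i123.add i4
        show ∫ q in A, (3 * M * ‖gv q‖ ^ 2 + ‖gP q‖ ^ 2 + ‖gY 0 q‖ ^ 2 + ‖gY 1 q‖ ^ 2
            + ‖gY 2 q‖ ^ 2) = _
        rw [integral_add i1234 i5, integral_add i123 i4, integral_add i12 i3, integral_add i1 i2,
          integral_const_mul]
      rw [eQ, hK]
      have b1 := integral_sg_sq_le (hvC 0) hvH hAm hA' hAc
      have b2 := integral_sg_sq_le hPC hPH hAm hA' hAc
      have b3 := integral_sg_sq_le (hYC 0) (hYH 0) hAm hA' hAc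
      have b4 := integral_sg_sq_le (hYC 1) (hYH 1) hAm hA' hAc
      have b5 := integral_sg_sq_le (hYC 2) (hYH 2) hAm hA' hAc
      have := mul_le_mul_of_nonneg_left b1 (by positivity : (0 : ℝ) ≤ 3 * M)
      linarith
    have hc0 : 0 ≤ c := by positivity
    have := mul_le_mul_of_nonneg_left hQle hc0
    linarith
  -- (3) contradiction for `N` large
  have hbig := hN ((2 * M * vB + c * K) * 2 / vB + 1) (by positivity)
  have e : ((2 * M * vB + c * K) * 2 / vB + 1) * vB / 2 = (2 * M * vB + c * K) + vB / 2 := by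
    have hv : vB ≠ 0 := hvB_pos.ne'
    calc ((2 * M * vB + c * K) * 2 / vB + 1) * vB / 2
        = (2 * M * vB + c * K) * (vB / vB) + vB / 2 := by ring
      _ = (2 * M * vB + c * K) + vB / 2 := by rw [div_self hv, mul_one]
  rw [e] at hbig
  linarith

-- The forcing route also reaches the literal Step 2 (type `¬ Theorem2Barriers`, already landed
-- as `not_Theorem2Barriers`, p467801): an `example`, not a new constant (chair 05:10:18Z).
example : ¬ Theorem2Barriers := fun h => not_Theorem2Barriers' (theorem2Barriers'_of_literal h)

end Summit.NavierStokesRegularity.NavierStokesRegularity.Theorems.Smith2006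

end
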